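import Literature.NumberTheory.GaloisRepresentations.LubinTateColemanRelativeFunctorialTwo
import HarnessLib

/-!
# `q = 2`: Coleman's logarithmic derivative `δ_E G = ω_F · G'/G` on `𝒪_E⟦X⟧ˣ` and the identity `𝒮_E(δ_E G) = π · δ_E(𝒩_E G)`;
# hence `𝒩_E G = G^φ ⟹ 𝒮_E(δ_E G) = π · (δ_E G)^φ` (de Shalit I §3.12 Corollary, relative situation)

De Shalit, *Iwasawa theory of elliptic curves with complex multiplication* (1987), Ch. I §3.12, Corollary: over an unramified
base `k'` with Frobenius `φ`, "`δg = D log g` maps `{g : 𝒩g = g^φ}` onto `{h : 𝒮h = h^φ}`".  The tree's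
`LubinTateColemanLogDeriv` does this for `𝒪_F`-coefficients (`logDeriv`, `colemanTrace_logDeriv`: `𝒮(δg) = π·δ(𝒩g)`).  THIS FILE:
the same over `𝒪_E` for any finite `E ⊇ F` at `q = 2` (`f = πX + X²`, `W_f^1 = {0, −π}` is `F`-rational, the operators
`𝒩_E = relNormTwo`, `𝒮_E = relTraceTwo` and the reflection `τ_E G = G(−π−X)` of `LubinTateColemanRelativeTraceTwo`), with the
tree normalisation `(𝒮_E h) ∘ f = h + τ_E h`.  Everything PROVED (0 sorry):

* `relLogDeriv E G = ι(ω_F) · G'/G` (`ω_F = invDiff` the invariant differential of `F_f`); `relLogDeriv_mul`, `relLogDeriv_one`,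
  `relLogDeriv_map` (functorial in ring maps `𝒪_{E₁} → 𝒪_{E₂}` over `𝒪_F`: twists `ψ` and inclusions `ι`).
* `relLogDeriv_reflE` — **`δ_E(τ_E G) = τ_E(δ_E G)`** (translation invariance of `ω_F`: `ω_F(X [+] ω₁)·(X [+] ω₁)' = ω_F`).
* ★★ `relTraceTwo_relLogDeriv` — **`𝒮_E(δ_E G) = π · δ_E(𝒩_E G)`** (logarithmic derivative of `(𝒩_E G) ∘ f = G · τ_E G` and
  `ω_F · f' = π · ω_F ∘ f`).
* ★★ `relTraceTwo_relLogDeriv_of_relNormTwo_eq_map` — **`𝒩_E G = G^ψ ⟹ 𝒮_E(δ_E G) = π · (δ_E G)^ψ`** for any ring endomorphism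
  `ψ` of `𝒪_E` over `𝒪_F` (the Frobenius): `δ_E` maps the twisted-`𝒩_E`-invariant units (the relative Coleman series
  `g_β`, `LubinTateColemanRelativeSeriesTwo`) into the twisted `𝒮_E`-eigenseries `{h : 𝒮_E h = π h^ψ}` — the input of the
  twisted Lemma 3.13 (`LubinTateColemanRelativeTildeTwo.exists_twistedTilde_eq`) and of Theorem I.3.7 over `k'`.

## References

* E. de Shalit, *Iwasawa theory of elliptic curves with complex multiplication* (1987), Ch. I §3.5, §3.12 Corollary. [deShalit1987]
* R. Coleman, *Division values in local fields*, Invent. Math. 53 (1979). [Coleman1979]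

## Tree reuse

`PowerSeries.dlog(_mul,_eq_of_map,_eq_of_map_eq,_eq_of_subst_eq)`, `LubinTate.invDiff`, `LubinTate.transl_invDiff`,
`LubinTate.derivative_evT`, `LubinTate.evT_map`, `invDiff_mul_derivative_ltSer` (`LubinTateColemanLogDeriv`), `reflE(_apply)`,
`subst_relNormTwo`, `subst_relTraceTwo`, `subst_map_ltSer_injective`, `map_relNormTwo` (`…RelativeTraceTwo`, `…CongruenceTwo`).
-/

noncomputable section

open scoped PowerSeries.WithPiTopology

namespace Literature.NumberTheory.GaloisRepresentations

/-- `d⁄dX` commutes with coefficientwise maps (private copy of a tree one-liner). [folklore] -/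
private theorem derivative_map'' {R T : Type*} [CommRing R] [CommRing T] (φ : R →+* T) (G : PowerSeries R) :
    PowerSeries.derivative T (G.map φ) = (PowerSeries.derivative R G).map φ := by
  ext n
  simp only [PowerSeries.coeff_derivative, PowerSeries.coeff_map, map_mul, map_add, map_natCast, map_one]

section RelativeLogDerivTwo

open GaloisRepresentations.IsNonarchimedeanLocalField LubinTate ValuativeRel

variable (F : Type*) [Field F] [ValuativeRel F] [TopologicalSpace F] [IsNonarchimedeanLocalField F]

attribute [local instance] ltNormUniformSpace ltNormIsUniformAddGroup rk1 nF nE fintypeResidueField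

variable {F}
variable {π : 𝒪[F]} (hπ : (valuation F).IsUniformizer (π : F))
variable (E : IntermediateField F (AlgebraicClosure F)) [FiniteDimensional F E]

/-! ### The logarithmic derivative on `𝒪_E⟦X⟧ˣ` -/

/-- **Coleman's logarithmic derivative over `𝒪_E`**: `δ_E G := ι(ω_F) · G'/G` for a unit `G` of `𝒪_E⟦X⟧`
(`ω_F = 1/λ_f'` the invariant differential of `F_f`, read in `𝒪_E⟦X⟧`). [cite: deShalit1987, Ch. I §3.12] -/
def relLogDeriv (G : (PowerSeries (unitBall E))ˣ) : PowerSeries (unitBall E) :=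
  (invDiff (isLTRing_LTCoeff hπ) (isLTSeries_LTCoeff π)).map (algebraMap (LTCoeff F) (unitBall E)) * PowerSeries.dlog G

/-- Unfolding. [cite: deShalit1987, Ch. I §3.12] -/
theorem relLogDeriv_def (G : (PowerSeries (unitBall E))ˣ) :
    relLogDeriv hπ E G =
      (invDiff (isLTRing_LTCoeff hπ) (isLTSeries_LTCoeff π)).map (algebraMap (LTCoeff F) (unitBall E)) *
        PowerSeries.dlog G := rfl

/-- `δ_E(G H) = δ_E G + δ_E H`. [cite: deShalit1987, Ch. I §3.12] -/
theorem relLogDeriv_mul (G H : (PowerSeries (unitBall E))ˣ) :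
    relLogDeriv hπ E (G * H) = relLogDeriv hπ E G + relLogDeriv hπ E H := by
  rw [relLogDeriv, relLogDeriv, relLogDeriv, PowerSeries.dlog_mul, mul_add]

/-- `δ_E 1 = 0`. [cite: deShalit1987, Ch. I §3.12] -/
theorem relLogDeriv_one : relLogDeriv hπ E (1 : (PowerSeries (unitBall E))ˣ) = 0 := by
  rw [relLogDeriv, PowerSeries.dlog_one, mul_zero]

variable {E} in
/-- **`δ` is functorial in ring maps over `𝒪_F`**: for `ψ : 𝒪_{E₁} → 𝒪_{E₂}` with `ψ ∘ ι₁ = ι₂` on `𝒪_F` (an inclusion,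
a Frobenius twist), `δ_{E₂}(G^ψ) = (δ_{E₁} G)^ψ`. [cite: deShalit1987, Ch. I §3.12] -/
theorem relLogDeriv_map {E₂ : IntermediateField F (AlgebraicClosure F)} [FiniteDimensional F E₂]
    {ψ : unitBall E →+* unitBall E₂}
    (hψ : ∀ a : LTCoeff F, ψ (algebraMap (LTCoeff F) (unitBall E) a) = algebraMap (LTCoeff F) (unitBall E₂) a)
    (G : (PowerSeries (unitBall E))ˣ) :
    relLogDeriv hπ E₂ (Units.map (PowerSeries.map ψ).toMonoidHom G) = PowerSeries.map ψ (relLogDeriv hπ E G) := by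
  have hcomp : ψ.comp (algebraMap (LTCoeff F) (unitBall E)) = algebraMap (LTCoeff F) (unitBall E₂) := RingHom.ext hψ
  rw [relLogDeriv, relLogDeriv, map_mul, PowerSeries.dlog_eq_of_map_eq ψ G _ rfl]
  congr 1
  rw [← RingHom.comp_apply (PowerSeries.map ψ) (PowerSeries.map (algebraMap (LTCoeff F) (unitBall E))),
    ← PowerSeries.map_comp, hcomp]

/-! ### `δ_E` commutes with the reflection `τ_E` -/

/-- The reflection `τ_E` as a unit map: `τ_E G` for a unit `G`. [cite: deShalit1987, Ch. I §3.12] -/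
def reflEUnit (G : (PowerSeries (unitBall E))ˣ) : (PowerSeries (unitBall E))ˣ := Units.map (reflE hπ E).toRingHom.toMonoidHom G

/-- Unfolding. [cite: deShalit1987, Ch. I §3.12] -/
theorem coe_reflEUnit (G : (PowerSeries (unitBall E))ˣ) :
    ((reflEUnit hπ E G : (PowerSeries (unitBall E))ˣ) : PowerSeries (unitBall E)) = reflE hπ E G := rfl

/-- ★ **`δ_E(τ_E G) = τ_E(δ_E G)`**: `τ_E` is translation by the division point `−π`, `ω_F` is translation invariant
(`ω_F(X [+] ω₁) · (X [+] ω₁)' = ω_F`) and `(G(X [+] ω₁))' = G'(X [+] ω₁) · (X [+] ω₁)'`. [cite: deShalit1987, Ch. I §3.5, §3.12] -/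
theorem relLogDeriv_reflE (G : (PowerSeries (unitBall E))ˣ) :
    relLogDeriv hπ E (reflEUnit hπ E G) = reflE hπ E (relLogDeriv hπ E G) := by
  set M := maxNilIdeal F E
  set t := tPt M (isLTRing_LTCoeff hπ) (isLTSeries_LTCoeff π) (divPtTwo hπ E 1) with ht
  have hdlog : PowerSeries.dlog (reflEUnit hπ E G) =
      reflE hπ E (PowerSeries.dlog G) * PowerSeries.derivative (unitBall E) (t : PowerSeries (unitBall E)) :=
    PowerSeries.dlog_eq_of_map (reflE hπ E).toRingHom _ (fun H => by
      change PowerSeries.derivative _ (reflE hπ E H) = reflE hπ E _ * _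
      rw [reflE_apply, reflE_apply, derivative_evT]) G _ rfl
  have hω : reflE hπ E ((invDiff (isLTRing_LTCoeff hπ) (isLTSeries_LTCoeff π)).map (algebraMap (LTCoeff F) (unitBall E))) =
      PowerSeries.derivative (unitBall E) (t : PowerSeries (unitBall E)) *
        (invDiff (isLTRing_LTCoeff hπ) (isLTSeries_LTCoeff π)).map (algebraMap (LTCoeff F) (unitBall E)) := by
    rw [reflE_apply, evT_map, ← transl, transl_invDiff]
  rw [relLogDeriv, relLogDeriv, hdlog, map_mul, hω]
  ring

/-! ### `𝒮_E(δ_E G) = π · δ_E(𝒩_E G)` -/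

variable (hq : residueFieldCard F = 2)

/-- `𝒩_E G` of a unit as a unit. [cite: deShalit1987, Ch. I §2.1] -/
def relNormTwoUnit (G : (PowerSeries (unitBall E))ˣ) : (PowerSeries (unitBall E))ˣ := Units.map (relNormTwoHom hπ E hq) G

/-- Unfolding. [cite: deShalit1987, Ch. I §2.1] -/
theorem coe_relNormTwoUnit (G : (PowerSeries (unitBall E))ˣ) :
    ((relNormTwoUnit hπ E hq G : (PowerSeries (unitBall E))ˣ) : PowerSeries (unitBall E)) = relNormTwo hπ E hq G := rfl

/-- **`ι ω_F · (ι f)' = π · (ι ω_F) ∘ ι f`** in `𝒪_E⟦X⟧` (`[π]`-equivariance of the invariant derivation).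
[cite: deShalit1987, Ch. I §3.5] -/
theorem map_invDiff_mul_derivative_map_ltSer :
    (invDiff (isLTRing_LTCoeff hπ) (isLTSeries_LTCoeff π)).map (algebraMap (LTCoeff F) (unitBall E)) *
        PowerSeries.derivative (unitBall E) ((ltSer F π).map (algebraMap (LTCoeff F) (unitBall E))) =
      PowerSeries.C (algebraMap 𝒪[F] (unitBall E) π) *
        ((invDiff (isLTRing_LTCoeff hπ) (isLTSeries_LTCoeff π)).map (algebraMap (LTCoeff F) (unitBall E))).subst
          ((ltSer F π).map (algebraMap (LTCoeff F) (unitBall E))) := by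
  have hfs : PowerSeries.HasSubst (ltSer F π) :=
    PowerSeries.HasSubst.of_constantCoeff_zero' (isLTSeries_ltSer π).constantCoeff_eq_zero
  have h := congrArg (PowerSeries.map (algebraMap (LTCoeff F) (unitBall E))) (invDiff_mul_derivative_ltSer hπ)
  have e2 : PowerSeries.map (algebraMap (LTCoeff F) (unitBall E))
      (PowerSeries.subst (ltSer F π) (invDiff (isLTRing_LTCoeff hπ) (isLTSeries_LTCoeff π))) =
      PowerSeries.subst ((ltSer F π).map (algebraMap (LTCoeff F) (unitBall E)))
        ((invDiff (isLTRing_LTCoeff hπ) (isLTSeries_LTCoeff π)).map (algebraMap (LTCoeff F) (unitBall E))) :=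
    PowerSeries.map_subst hfs _
  rw [map_mul, map_mul, PowerSeries.map_C, e2, ← derivative_map''] at h
  exact h

/-- ★★ **`𝒮_E(δ_E G) = π · δ_E(𝒩_E G)`** for every unit `G ∈ 𝒪_E⟦X⟧ˣ` (`q = 2`): the logarithmic derivative (for the
invariant derivation) of `(𝒩_E G) ∘ f = G · τ_E G`, with `δ_E(τ_E G) = τ_E(δ_E G)` and `ω_F·f' = π·ω_F ∘ f`.
[cite: deShalit1987, Ch. I §3.12] -/
theorem relTraceTwo_relLogDeriv (G : (PowerSeries (unitBall E))ˣ) :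
    relTraceTwo hπ E hq (relLogDeriv hπ E G) =
      PowerSeries.C (algebraMap 𝒪[F] (unitBall E) π) * relLogDeriv hπ E (relNormTwoUnit hπ E hq G) := by
  have hfS0 : PowerSeries.constantCoeff ((ltSer F π).map (algebraMap (LTCoeff F) (unitBall E))) = 0 :=
    ((isLTSeries_ltSer π).map _).constantCoeff_eq_zero
  have hfSs : PowerSeries.HasSubst ((ltSer F π).map (algebraMap (LTCoeff F) (unitBall E))) :=
    PowerSeries.HasSubst.of_constantCoeff_zero' hfS0
  refine subst_map_ltSer_injective hπ E ?_
  change PowerSeries.subst ((ltSer F π).map (algebraMap (LTCoeff F) (unitBall E))) (relTraceTwo hπ E hq (relLogDeriv hπ E G)) =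
    PowerSeries.subst ((ltSer F π).map (algebraMap (LTCoeff F) (unitBall E)))
      (PowerSeries.C (algebraMap 𝒪[F] (unitBall E) π) * relLogDeriv hπ E (relNormTwoUnit hπ E hq G))
  -- `(𝒩_E G) ∘ f = G · τ_E G` as units, and its `dlog`
  have hprod : ((G * reflEUnit hπ E G : (PowerSeries (unitBall E))ˣ) : PowerSeries (unitBall E)) =
      ((relNormTwoUnit hπ E hq G : (PowerSeries (unitBall E))ˣ) : PowerSeries (unitBall E)).subst
        ((ltSer F π).map (algebraMap (LTCoeff F) (unitBall E))) := by
    rw [Units.val_mul, coe_reflEUnit, coe_relNormTwoUnit, subst_relNormTwo]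
  have h1 := PowerSeries.dlog_eq_of_subst_eq hfSs (relNormTwoUnit hπ E hq G) (G * reflEUnit hπ E G) hprod
  rw [PowerSeries.dlog_mul] at h1
  -- left side: `(𝒮_E δG) ∘ f = δG + τ δG = δG + δ(τG) = ι ω_F · dlog(G·τG) = ι ω_F · (dlog 𝒩G) ∘ f · f'`
  rw [subst_relTraceTwo, ← relLogDeriv_reflE, relLogDeriv_def, relLogDeriv_def, relLogDeriv_def, ← mul_add, h1]
  -- right side: `subst` is an `𝒪_E`-algebra map
  have hC : ∀ c : unitBall E, PowerSeries.subst ((ltSer F π).map (algebraMap (LTCoeff F) (unitBall E))) (PowerSeries.C c) =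
      PowerSeries.C c := fun c => by
    rw [← PowerSeries.coe_substAlgHom hfSs, PowerSeries.C_eq_algebraMap, AlgHom.commutes]
  rw [← PowerSeries.coe_substAlgHom hfSs, map_mul, map_mul, PowerSeries.coe_substAlgHom, hC]
  linear_combination (PowerSeries.subst ((ltSer F π).map (algebraMap (LTCoeff F) (unitBall E)))
    (PowerSeries.dlog (relNormTwoUnit hπ E hq G))) * map_invDiff_mul_derivative_map_ltSer hπ E

/-- ★★ **`𝒩_E G = G^ψ ⟹ 𝒮_E(δ_E G) = π · (δ_E G)^ψ`** for a ring endomorphism `ψ` of `𝒪_E` over `𝒪_F` (the Frobenius):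
`δ_E` carries the twisted-`𝒩_E`-invariant units (relative Coleman series) to the twisted `𝒮_E`-eigenseries — de Shalit's
Cor. I.3.12 "`δ` maps `{g : 𝒩g = g^φ}` into `{h : 𝒮h = h^φ}`" with the tree's normalisation of `𝒮`.
[cite: deShalit1987, Ch. I §3.12 Corollary] -/
theorem relTraceTwo_relLogDeriv_of_relNormTwo_eq_map {ψ : unitBall E →+* unitBall E}
    (hψ : ∀ a : LTCoeff F, ψ (algebraMap (LTCoeff F) (unitBall E) a) = algebraMap (LTCoeff F) (unitBall E) a)
    (G : (PowerSeries (unitBall E))ˣ) (hG : relNormTwo hπ E hq G = PowerSeries.map ψ G) :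
    relTraceTwo hπ E hq (relLogDeriv hπ E G) =
      PowerSeries.C (algebraMap 𝒪[F] (unitBall E) π) * PowerSeries.map ψ (relLogDeriv hπ E G) := by
  rw [relTraceTwo_relLogDeriv hπ E hq G, ← relLogDeriv_map hπ hψ G]
  congr 2
  exact Units.ext hG

end RelativeLogDerivTwo

end Literature.NumberTheory.GaloisRepresentations
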